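import Mathlib
import Summits.KontsevichZagierPeriods.Zeta5Search.ZeroWindowClasses
import Summits.KontsevichZagierPeriods.Zeta5Search.TypeSpaceLawZeroPointProof
import Summits.KontsevichZagierPeriods.Zeta5Search.Ray5Windows
import Summits.KontsevichZagierPeriods.Zeta5Search.Ray1WindowsDeep
import Summits.KontsevichZagierPeriods.Zeta5Search.Ray5Z13o5
import Summits.KontsevichZagierPeriods.Zeta5Search.Ray1Z32o5
import Summits.KontsevichZagierPeriods.Zeta5Search.Ray1Z64o11
import HarnessLib

/-!
# ζ(5) search — ONE-POINT zero windows: `TypeSpaceLawZeroPoint` (`casLB + 4`) through `ZeroWindowClasses` with a SINGLE point value (HONEST FRAMING: systematic search; no irrationality claim unless certified)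

Cell `pub-zeta5`, prover seat p3 generation 4.  Census g21's `ZeroWindows.bound_of_classes` turns a window class structure
`ZeroWindowClasses b p M D S` with at most TWO point values (`|D| + |S| ≤ 2`, pigeonhole ⇒ (h7)) into the ZERO type-space bound
`v_p(Cas_j(b)) ≥ 6 − 2M` (`typeSpaceLawZero_holds`).  When the window carries only ONE point value (`|D| + |S| ≤ 1`: a single deep
palindrome and no extra pair, or no deep class and one extra pair) every two live orbit points are EQUAL, which is the hypothesis of the
sharper tree theorem `ResidueLaw.typeSpaceLawZeroPoint_holds` (`TypeSpaceLawZeroPointProof.lean`): `v_p(Cas_j(b)) ≥ 7 − 2M`, one more unit.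
This file proves that reduction (`point_eq_of_classes`, `pointBound_of_classes`), the general-ray form (`T1Rays.zeroPointWindow_of_classes`, as
`T1RayKit.zeroWindow_of_classes`) and its ray-5 / ray-1 specialisations, and applies it to the typed one-value windows of the T1-map rays:
ray 5 `θ ∈ (18/7, 13/5]` (`M = 32`, `Dz32` alone — class node already a THEOREM, `Ray5Z13o5.ray5ZeroClassesZ13o5_holds`, so the sharpened
window `Ray5WindowZ13o5pt` (`−57` instead of `−58`) is proved here outright), ray 1 `θ ∈ (19/3, 32/5]` (`M = 22`, one pair) and
`θ ∈ (23/4, 64/11]` (`M = 24`, `Dz24` alone) (`−37`, `−41`) from their `Ray1WindowsDeep` class nodes, p3 g4's tree theorems `Ray1Z32o5.…_holds` / `Ray1Z64o11.…_holds` — all three sharpened windows UNCONDITIONAL.  `p`-adic bookkeeping of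
rational numbers; nothing here bears on irrationality.
-/

noncomputable section

open Finset

namespace Summit.KontsevichZagierPeriods.Zeta5Search.ZeroWindows

open Summit.KontsevichZagierPeriods.Zeta5Search.CasoratianValuation (InPolytope shift casoratian)
open Summit.KontsevichZagierPeriods.Zeta5Search.ClusterValuation
open Summit.KontsevichZagierPeriods.Zeta5Search.SecondOrder
open Summit.KontsevichZagierPeriods.Zeta5Search.ResidueLaw

variable {p : ℕ} [hp : Fact p.Prime]

/-- **One point value ⇒ all live orbit points coincide.**  Under `ZeroWindowClasses b p M D S` with `|D| + |S| ≤ 1` any two live classes have the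
same doubled orbit point (census g21's `point_mem_vals`: every live point lies in the list `D.map deepPoint ++ S.map pairPoint`, here of length ≤ 1). -/
theorem point_eq_of_classes (b : ℕ → ℤ) (hb : InPolytope b) (hpn : (p : ℤ) ≤ b 0) {M : ℕ} (hM : 6 ≤ M) (hMe : Even M)
    {D S : List (List ℤ)} (hD : ∀ T ∈ D, T.reverse = T) (hC : ZeroWindowClasses b p M D S) (hlen : D.length + S.length ≤ 1)
    {x y : ℕ} (hx : x ∈ liveClasses b p M) (hy : y ∈ liveClasses b p M) :
    pointW b p M y = pointW b p M x ∧ pointV b p M y = pointV b p M x := by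
  have hx' := point_mem_vals b hb hpn hM hMe hD hC hx
  have hy' := point_mem_vals b hb hpn hM hMe hD hC hy
  generalize hv : D.map deepPoint ++ S.map pairPoint = vals at hx' hy'
  have hl : vals.length ≤ 1 := by
    rw [← hv, List.length_append, List.length_map, List.length_map]; exact hlen
  match vals, hl, hx', hy' with
  | [], _, hx', _ => simp at hx'
  | [v], _, hx', hy' =>
      simp only [List.mem_singleton] at hx' hy'
      rw [← hy'] at hx'
      simp only [Prod.mk.injEq] at hx'
      exact ⟨hx'.1.symm, hx'.2.symm⟩
  | _ :: _ :: _, hl, _, _ => simp at hl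

/-- **`TypeSpaceLawZeroPoint` through `ZeroWindowClasses` (one point value)**: on the polytope with `5 ≤ p ≤ b₀ < p² − 2`, `M ≥ 6` even, DEG,
deep palindromes `D` and extra pairs `S` with `|D| + |S| ≤ 1`:  `v_p(Cas_j(b)) ≥ 7 − 2M` (tree theorem `typeSpaceLawZeroPoint_holds`). -/
theorem pointBound_of_classes (b : ℕ → ℤ) (j M : ℕ) (D S : List (List ℤ)) (hb : InPolytope b) (hbj : InPolytope (shift b j))
    (hj1 : 1 ≤ j) (hj7 : j ≤ 7) (h5 : 5 ≤ p) (hpn : (p : ℤ) ≤ b 0) (hp2 : (b 0 + 2 : ℤ) < (p : ℤ) ^ 2) (hM : 6 ≤ M) (hMe : Even M)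
    (hdeg : (p : ℤ) * ((M : ℤ) - 2) + ∑ x ∈ range p, classExp b p x ≤ -4)
    (hD : ∀ T ∈ D, T.reverse = T) (hlen : D.length + S.length ≤ 1) (hC : ZeroWindowClasses b p M D S)
    (hne : casoratian b j ≠ 0) : (7 : ℤ) - 2 * M ≤ padicValRat p (casoratian b j) := by
  have G1 := hC.1
  have G3 : ∀ x, x < p → 1 ≤ classPoleCount b p x → classExp b p x = -(M : ℤ) →
      ¬ CentreIn b p x ∧ (classTypeList b p x).reverse = classTypeList b p x :=
    fun x hx h1 hE => ⟨(hC.2.1 x hx h1 hE).1, hD _ (hC.2.1 x hx h1 hE).2⟩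
  refine typeSpaceLawZeroPoint_holds b p j M hb hbj hj1 hj7 hp.out h5 hpn hp2 hM hMe G1 G3 hdeg ?_ hne
  intro x hx y hy
  obtain ⟨hW, hV⟩ := point_eq_of_classes b hb hpn hM hMe hD hC hlen hx hy
  exact ⟨Or.inl (by rw [hW, sub_self]), Or.inl (by rw [hV, sub_self])⟩

end Summit.KontsevichZagierPeriods.Zeta5Search.ZeroWindows

namespace Summit.KontsevichZagierPeriods.Zeta5Search.T1Rays

open Summit.KontsevichZagierPeriods.Zeta5Search.CasoratianValuation (InPolytope shift casoratian)
open Summit.KontsevichZagierPeriods.Zeta5Search.ClusterValuation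
open Summit.KontsevichZagierPeriods.Zeta5Search.SecondOrder
open Summit.KontsevichZagierPeriods.Zeta5Search.ResidueLaw
open Summit.KontsevichZagierPeriods.Zeta5Search.WedgeDictionary (dOf)
open Summit.KontsevichZagierPeriods.Zeta5Search.ZeroWindows (ZeroWindowClasses pointBound_of_classes)

variable {p : ℕ}

/-- **ONE-POINT window reduction for an arbitrary parameter function** (as `T1RayKit.zeroWindow_of_classes`, with `|D| + |S| ≤ 1` and the bound
`7 − 2M`). -/
theorem zeroPointWindow_of_classes (b : ℕ → ℤ) (B : ℕ) (d : ℤ) (p M : ℕ) (D S : List (List ℤ))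
    (hb : InPolytope b) (hb7 : InPolytope (shift b 7)) (hB : b 0 = (B : ℤ)) (hd : dOf b = d)
    (hp : p.Prime) (h5 : 5 ≤ p) (hpn : p ≤ B) (hp2 : B + 2 < p ^ 2) (hM : 6 ≤ M) (hMe : Even M)
    (hdeg : (p : ℤ) * ((M : ℤ) - 2) ≤ 2 * d + 1)
    (hD : ∀ T ∈ D, T.reverse = T) (hlen : D.length + S.length ≤ 1) (hC : ZeroWindowClasses b p M D S)
    (hne : casoratian b 7 ≠ 0) : (7 : ℤ) - 2 * M ≤ padicValRat p (casoratian b 7) := by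
  haveI : Fact p.Prime := ⟨hp⟩
  have hpb : (p : ℤ) ≤ b 0 := by rw [hB]; exact_mod_cast hpn
  have hp2' : (b 0 + 2 : ℤ) < (p : ℤ) ^ 2 := by rw [hB]; exact_mod_cast hp2
  have hdeg' : (p : ℤ) * ((M : ℤ) - 2) + ∑ x ∈ range p, classExp b p x ≤ -4 := by
    rw [sum_classExp_range b hb h5, hd]; omega
  exact pointBound_of_classes b 7 M D S hb hb7 (by norm_num) (by norm_num) h5 hpb hp2' hM hMe hdeg' hD hlen hC hne

/-- The ONE-POINT reduction on ray #5 (`b₀ = 51n`, `d = 39n`). -/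
theorem ray5ZeroPoint_of_classes (n p M : ℕ) (D S : List (List ℤ)) (hn : 1 ≤ n) (hp : p.Prime) (h5 : 5 ≤ p) (hpn : p ≤ 51 * n)
    (hp2 : 51 * n + 2 < p ^ 2) (hM : 6 ≤ M) (hMe : Even M) (hdeg : (p : ℤ) * ((M : ℤ) - 2) ≤ 78 * n + 1)
    (hD : ∀ T ∈ D, T.reverse = T) (hlen : D.length + S.length ≤ 1) (hC : ZeroWindowClasses (bRay β5 n) p M D S)
    (hne : casoratian (bRay β5 n) 7 ≠ 0) : (7 : ℤ) - 2 * M ≤ padicValRat p (casoratian (bRay β5 n) 7) :=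
  zeroPointWindow_of_classes (bRay β5 n) (51 * n) (39 * n) p M D S (inPolytope_ray5 n) (inPolytope_shift_ray5 hn) (ray5_zero n)
    (dOf_ray5 n) hp h5 hpn hp2 hM hMe (by omega) hD hlen hC hne

/-- The ONE-POINT reduction on ray #1 (`b₀ = 85n`, `d = 64n`). -/
theorem ray1ZeroPoint_of_classes (n p M : ℕ) (D S : List (List ℤ)) (hn : 1 ≤ n) (hp : p.Prime) (h5 : 5 ≤ p) (hpn : p ≤ 85 * n)
    (hp2 : 85 * n + 2 < p ^ 2) (hM : 6 ≤ M) (hMe : Even M) (hdeg : (p : ℤ) * ((M : ℤ) - 2) ≤ 128 * n + 1)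
    (hD : ∀ T ∈ D, T.reverse = T) (hlen : D.length + S.length ≤ 1) (hC : ZeroWindowClasses (bRay β1 n) p M D S)
    (hne : casoratian (bRay β1 n) 7 ≠ 0) : (7 : ℤ) - 2 * M ≤ padicValRat p (casoratian (bRay β1 n) 7) :=
  zeroPointWindow_of_classes (bRay β1 n) (85 * n) (64 * n) p M D S (inPolytope_ray1 n) (inPolytope_shift_ray1 hn) (ray1_zero n)
    (dOf_ray1 n) hp h5 hpn hp2 hM hMe (by omega) hD hlen hC hne

/-! ## The one-value windows of the T1 rays, sharpened by one unit -/

/-- **RAY-#5 WINDOW `θ ∈ (18/7, 13/5]`, ONE-POINT form** (`M = 32`, the single deep palindrome `Dz32`, no pair): `v_p(Cas₇(b(n))) ≥ −57 = 7 − 2M`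
(one unit sharper than `Ray5WindowZ13o5`). -/
def Ray5WindowZ13o5pt : Prop :=
  ∀ n p : ℕ, 2 ≤ n → p.Prime → 18 * n < 7 * p → 5 * p ≤ 13 * n → 51 * n + 2 < p ^ 2 → casoratian (bRay β5 n) 7 ≠ 0 →
    (-57 : ℤ) ≤ padicValRat p (casoratian (bRay β5 n) 7)

/-- **`Ray5WindowZ13o5pt` IS A THEOREM** (unconditional): the class node `Ray5ZeroClassesZ13o5` is p3 g4's tree theorem
`Ray5Z13o5.ray5ZeroClassesZ13o5_holds`, and `|Dz32| + |Sz32| = 1`. -/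
theorem ray5WindowZ13o5pt_holds : Ray5WindowZ13o5pt := by
  intro n p hn hp h1 h2 hw hne
  exact ray5ZeroPoint_of_classes n p 32 Dz32 Sz32 (by omega) hp (by omega) (by omega) hw (by norm_num) (by decide)
    (by push_cast; omega) (by decide) (by decide) (Ray5Z13o5.ray5ZeroClassesZ13o5_holds n p hn hp h1 h2 hw) hne

/-- **RAY-#1 WINDOW `θ ∈ (19/3, 32/5]`, ONE-POINT form** (`M = 22`, no deep class, the single pair `Sz22r1`): `v_p(Cas₇(b(n))) ≥ −37 = 7 − 2M`. -/
def Ray1WindowZ32o5pt : Prop :=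
  ∀ n p : ℕ, 2 ≤ n → p.Prime → 19 * n < 3 * p → 5 * p ≤ 32 * n → 85 * n + 2 < p ^ 2 → casoratian (bRay β1 n) 7 ≠ 0 →
    (-37 : ℤ) ≤ padicValRat p (casoratian (bRay β1 n) 7)

/-- **`Ray1WindowZ32o5pt` from the class node `Ray1ZeroClassesZ32o5`.** -/
theorem ray1WindowZ32o5pt_of (hC : Ray1ZeroClassesZ32o5) : Ray1WindowZ32o5pt := by
  intro n p hn hp h1 h2 hw hne
  exact ray1ZeroPoint_of_classes n p 22 Dz14e Sz22r1 (by omega) hp (by omega) (by omega) hw (by norm_num) (by decide)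
    (by push_cast; omega) (by decide) (by decide) (hC n p hn hp h1 h2 hw) hne

/-- **`Ray1WindowZ32o5pt` IS A THEOREM** (unconditional): the class node is p3 g4's tree theorem `Ray1Z32o5.ray1ZeroClassesZ32o5_holds`. -/
theorem ray1WindowZ32o5pt_holds : Ray1WindowZ32o5pt := ray1WindowZ32o5pt_of Ray1Z32o5.ray1ZeroClassesZ32o5_holds

/-- **RAY-#1 WINDOW `θ ∈ (23/4, 64/11]`, ONE-POINT form** (`M = 24`, the single deep palindrome `Dz24`, no pair): `v_p(Cas₇(b(n))) ≥ −41 = 7 − 2M`. -/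
def Ray1WindowZ64o11pt : Prop :=
  ∀ n p : ℕ, 2 ≤ n → p.Prime → 23 * n < 4 * p → 11 * p ≤ 64 * n → 85 * n + 2 < p ^ 2 → casoratian (bRay β1 n) 7 ≠ 0 →
    (-41 : ℤ) ≤ padicValRat p (casoratian (bRay β1 n) 7)

/-- **`Ray1WindowZ64o11pt` from the class node `Ray1ZeroClassesZ64o11`.** -/
theorem ray1WindowZ64o11pt_of (hC : Ray1ZeroClassesZ64o11) : Ray1WindowZ64o11pt := by
  intro n p hn hp h1 h2 hw hne
  exact ray1ZeroPoint_of_classes n p 24 Dz24 Sz28 (by omega) hp (by omega) (by omega) hw (by norm_num) (by decide)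
    (by push_cast; omega) (by decide) (by decide) (hC n p hn hp h1 h2 hw) hne

/-- **`Ray1WindowZ64o11pt` IS A THEOREM** (unconditional): the class node is p3 g4's tree theorem `Ray1Z64o11.ray1ZeroClassesZ64o11_holds`. -/
theorem ray1WindowZ64o11pt_holds : Ray1WindowZ64o11pt := ray1WindowZ64o11pt_of Ray1Z64o11.ray1ZeroClassesZ64o11_holds

end Summit.KontsevichZagierPeriods.Zeta5Search.T1Rays

end
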